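import Literature.Computability.Complexity.TVSelfCorrect
import Literature.Computability.Complexity.SamplingChernoff
import HarnessLib

/-!
# Self-correction of Trevisan–Vadhan's `F` with independent trials and a majority vote
# (IW98 Def. 5 "`C^{f,1−n^{−c}} → C^f`" / TV07 Lemma 3.5, counting core)

Literature / complexity — derandomization (Case 2 of IW98 in TV07 form), sequel of `TVSelfCorrect.lean`.
There ONE trial — a random pad `pd` and `r` random lines `ys` — corrects a function `g` that errs on few
words of the canonical length `h n i` into `corrected g n pd ys`, which equals `F` on EVERY word of that
length unless the pad is bad (`card_badPads_le`, Markov) or the lines are bad (`card_badDirs_le`,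
Chernoff on lines); but the bad-pad probability is only polynomially small, whereas a strong construction
(IW98 Def. 4) must succeed with probability `1 − 1/a` for every `a`. The printed remedy is repetition:
`s` independent trials and a MAJORITY vote, whose failure is exponentially small in `s` as soon as a
single trial is good with probability `≥ 3/4` (Hoeffding, the counting version
`card_upperDeviation_le_exp` of `SamplingChernoff.lean`). This file is that layer, as pure counting:

* `QBFUniv.Trial n i r` (a pad and `r` lines), `QBFUniv.TrialGood` (the trial's corrector is the member
  `f_{n,i}` at every point), `QBFUniv.majCorrected` (strict majority of the `s` corrected bits);
* **`QBFUniv.majCorrected_eq_FB`** — if more than half of the trials are good, the majority is `F w` on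
  every `w` of length `h n i`;
* **`QBFUniv.card_badTrials_le`** — the bad trials are few: `#bad · (T+1) · … ≤` (bad pads, Markov) `+`
  (bad lines, `exp(−r/32)`), in the real-valued form used downstream;
* **`QBFUniv.card_badMajority_le_exp`** — if at most a quarter of the trials are bad, fewer than
  `exp(−s/8) · |Trial|^s` of the `s`-tuples of trials have at most half good trials; hence
  **`QBFUniv.card_majCorrected_ne_le`**: the tuples on which the majority-corrected function differs from
  `F` somewhere on `{0,1}^{h n i}` are at most `exp(−s/8) · |Trial|^s`.

Everything is proved; definitions are plain (no named facts).

## References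

* [ImpagliazzoWigderson2001] R. Impagliazzo, A. Wigderson, JCSS 63 (2001), §2.2 Def. 5 (random
  self-reducibility as `C^{f,1−n^{−c}} → C^f`), Def. 4 (success `1 − 1/a`).
* [TrevisanVadhan2007] L. Trevisan, S. Vadhan, Comput. Complexity 16 (2007), Lemma 3.5, Thm. 4.3 (proof:
  self-correction of `F`).
* [AroraBarakCC2009] S. Arora, B. Barak, CUP 2009, §7.4.1 (error reduction by majority, Chernoff).
-/

noncomputable section

namespace Literature.Computability.Complexity

namespace QBFUniv

open MvPolynomial Finset Literature.InformationTheory.Coding PolySelfCorrect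

open scoped Classical

variable {n i : ℕ}

/-! ### Trials and the majority vote -/

/-- **One trial's coins**: a pad and `r` lines (directions). [cite: TrevisanVadhan2007, Lemma 3.5] -/
abbrev Trial (n i r : ℕ) : Type := (Fin (padLen n i) → Bool) × (Fin r → Fin (N n) → K n)

/-- A trial is GOOD for `g` if its corrector returns the member `f_{n,i}` at every point. [folklore] -/
def TrialGood (g : List Bool → Bool) (n i r : ℕ) (c : Trial n i r) : Prop :=
  ∀ x, corr (nodes n) (ptOracle (n := n) g (List.ofFn c.1)) c.2 x = eval x (fam (K n) n i)

/-- A good trial's corrected function is `F` on every word of length `h n i`. [folklore] -/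
theorem corrected_eq_FB_of_good (hi : i ≤ mlen n) {g : List Bool → Bool} {r : ℕ} {c : Trial n i r}
    (hc : TrialGood g n i r c) {w : List Bool} (hw : w.length = h n i) :
    corrected g n (List.ofFn c.1) c.2 w = FB w :=
  corrected_eq_FB hi g hc hw

/-- **The majority-corrected function**: the strict majority of the `s` corrected bits.
[cite: TrevisanVadhan2007, Lemma 3.5] [cite: AroraBarakCC2009, §7.4.1] -/
def majCorrected (g : List Bool → Bool) (n : ℕ) {i s r : ℕ} (cs : Fin s → Trial n i r) (w : List Bool) : Bool :=
  decide (s < 2 * #(univ.filter fun t => corrected g n (List.ofFn (cs t).1) (cs t).2 w = true))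

/-- **If more than half of the trials are good, the majority is `F`** on every word of length `h n i`.
[cite: TrevisanVadhan2007, Lemma 3.5] -/
theorem majCorrected_eq_FB (hi : i ≤ mlen n) (g : List Bool → Bool) {s r : ℕ} (cs : Fin s → Trial n i r)
    (hgood : s < 2 * #(univ.filter fun t => TrialGood g n i r (cs t))) {w : List Bool} (hw : w.length = h n i) :
    majCorrected g n cs w = FB w := by
  classical
  rw [majCorrected]
  set G := univ.filter fun t => TrialGood g n i r (cs t) with hG
  set Tr := univ.filter fun t => corrected g n (List.ofFn (cs t).1) (cs t).2 w = true with hTr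
  have hGval : ∀ t ∈ G, corrected g n (List.ofFn (cs t).1) (cs t).2 w = FB w := fun t ht => by
    simp only [hG, mem_filter, mem_univ, true_and] at ht
    exact corrected_eq_FB_of_good hi ht hw
  cases hF : FB w
  · -- the true votes come from bad trials only: `Tr` and `G` are disjoint
    have hdisj : Disjoint Tr G := by
      refine disjoint_left.2 fun t ht htG => ?_
      simp only [hTr, mem_filter, mem_univ, true_and] at ht
      rw [hGval t htG, hF] at ht
      exact Bool.false_ne_true ht
    have h1 : #Tr + #G ≤ s := by
      rw [← card_union_of_disjoint hdisj]
      exact (card_le_univ _).trans (by simp)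
    exact decide_eq_false (by omega)
  · have hsub : G ⊆ Tr := fun t ht => by
      simp only [hTr, mem_filter, mem_univ, true_and]
      rw [hGval t ht, hF]
    have h1 := card_le_card hsub
    exact decide_eq_true (by omega)

/-! ### The bad trials are few -/

/-- The bad trials, as a finset. [folklore] -/
def badTrials (g : List Bool → Bool) (n i r : ℕ) : Finset (Trial n i r) := univ.filter fun c => ¬ TrialGood g n i r c

/-- **The bad trials are few.** With `T` the pad threshold: a trial is bad only if its pad has more than
`T` bad points, or its pad is good but its lines are bad; so, by `card_badPads_le` (Markov over pads) and
`card_badDirs_le` (Chernoff over lines),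
`#bad ≤ (blk n · #Bad / (T+1)) · |lines| + |pads| · |K|^N · exp(−r/32) · |lines|`.
[cite: ImpagliazzoWigderson2001, Def. 5] [cite: TrevisanVadhan2007, Lemma 3.5] -/
theorem card_badTrials_le (hi : i ≤ mlen n) (g : List Bool → Bool) (Bad : Finset (List Bool))
    (hBad : ∀ w : List Bool, w.length = h n i → g w ≠ FB w → w ∈ Bad) {T r : ℕ}
    (hTK : 4 * ((Dn n + 1) * T) ≤ Fintype.card (K n) ^ N n) (hr : 0 < r) :
    (#(badTrials g n i r) : ℝ) ≤
      (blk n * #Bad : ℝ) / (T + 1) * (Fintype.card (K n) : ℝ) ^ (N n * r) +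
        (2 : ℝ) ^ padLen n i * ((Fintype.card (K n) : ℝ) ^ N n * (Real.exp (-(r / 32 : ℝ)) * ((Fintype.card (K n) : ℝ) ^ N n) ^ r)) := by
  classical
  -- split by the pad
  set BP : Finset (Fin (padLen n i) → Bool) := univ.filter fun pd => T < #(badPts g n i pd) with hBP
  set Dirs := (Fin r → Fin (N n) → K n)
  have hcardDirs : (Fintype.card (Fin r → Fin (N n) → K n) : ℝ) = (Fintype.card (K n) : ℝ) ^ (N n * r) := by
    simp [Fintype.card_fin, pow_mul]
  -- bad trials ⊆ (bad pads × all dirs) ∪ Σ_{good pads} {pd} × badDirs pd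
  have hsub : badTrials g n i r ⊆
      (BP ×ˢ (univ : Finset Dirs)) ∪
        (univ.filter fun pd : Fin (padLen n i) → Bool => ¬ T < #(badPts g n i pd)).biUnion fun pd =>
          ({pd} : Finset _) ×ˢ (univ.filter fun ys : Dirs => ∃ x, corr (nodes n) (ptOracle g (List.ofFn pd)) ys x ≠ eval x (fam (K n) n i)) := by
    intro c hc
    simp only [badTrials, mem_filter, mem_univ, true_and, TrialGood, not_forall] at hc
    obtain ⟨x, hx⟩ := hc
    by_cases hp : T < #(badPts g n i c.1)
    · exact mem_union_left _ (mem_product.2 ⟨by rw [hBP]; simpa using hp, mem_univ _⟩)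
    · refine mem_union_right _ (mem_biUnion.2 ⟨c.1, mem_filter.2 ⟨mem_univ _, hp⟩, mem_product.2 ⟨mem_singleton_self _, ?_⟩⟩)
      simp only [mem_filter, mem_univ, true_and]
      exact ⟨x, hx⟩
  have h1 := card_le_card hsub
  have h2 := (card_union_le _ _).trans' h1
  -- first part: bad pads
  have hpads := card_badPads_le hi g Bad hBad T
  have hBPreal : (#BP : ℝ) ≤ (blk n * #Bad : ℝ) / (T + 1) := by
    rw [le_div_iff₀ (by positivity)]
    have : (#BP * (T + 1) : ℕ) ≤ blk n * #Bad := by rw [hBP]; exact hpads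
    exact_mod_cast this
  have hA : (#(BP ×ˢ (univ : Finset Dirs)) : ℝ) ≤ (blk n * #Bad : ℝ) / (T + 1) * (Fintype.card (K n) : ℝ) ^ (N n * r) := by
    rw [card_product, card_univ, Nat.cast_mul, hcardDirs]
    exact mul_le_mul_of_nonneg_right hBPreal (by positivity)
  -- second part: good pads, bad dirs
  have hB : (#((univ.filter fun pd : Fin (padLen n i) → Bool => ¬ T < #(badPts g n i pd)).biUnion fun pd =>
      ({pd} : Finset _) ×ˢ (univ.filter fun ys : Dirs => ∃ x, corr (nodes n) (ptOracle g (List.ofFn pd)) ys x ≠ eval x (fam (K n) n i))) : ℝ) ≤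
      (2 : ℝ) ^ padLen n i * ((Fintype.card (K n) : ℝ) ^ N n * (Real.exp (-(r / 32 : ℝ)) * ((Fintype.card (K n) : ℝ) ^ N n) ^ r)) := by
    refine (Nat.cast_le.2 card_biUnion_le).trans ?_
    rw [Nat.cast_sum]
    calc ∑ pd ∈ univ.filter (fun pd : Fin (padLen n i) → Bool => ¬ T < #(badPts g n i pd)),
          (#(({pd} : Finset _) ×ˢ (univ.filter fun ys : Dirs => ∃ x, corr (nodes n) (ptOracle g (List.ofFn pd)) ys x ≠ eval x (fam (K n) n i))) : ℝ)
        ≤ ∑ _pd ∈ univ.filter (fun pd : Fin (padLen n i) → Bool => ¬ T < #(badPts g n i pd)),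
            (Fintype.card (K n) : ℝ) ^ N n * (Real.exp (-(r / 32 : ℝ)) * ((Fintype.card (K n) : ℝ) ^ N n) ^ r) := by
          refine sum_le_sum fun pd hpd => ?_
          simp only [mem_filter, mem_univ, true_and, not_lt] at hpd
          rw [card_product, card_singleton, one_mul]
          exact card_badDirs_le g hpd hTK hr
      _ ≤ (2 : ℝ) ^ padLen n i * ((Fintype.card (K n) : ℝ) ^ N n * (Real.exp (-(r / 32 : ℝ)) * ((Fintype.card (K n) : ℝ) ^ N n) ^ r)) := by
          rw [sum_const, nsmul_eq_mul]
          refine mul_le_mul_of_nonneg_right ?_ (by positivity)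
          have : (#(univ.filter fun pd : Fin (padLen n i) → Bool => ¬ T < #(badPts g n i pd)) : ℝ) ≤ Fintype.card (Fin (padLen n i) → Bool) := by
            exact_mod_cast (card_filter_le _ _).trans (card_univ (α := Fin (padLen n i) → Bool)).le
          simpa [Fintype.card_fun, Fintype.card_fin, Fintype.card_bool] using this
  calc (#(badTrials g n i r) : ℝ) ≤ #(BP ×ˢ (univ : Finset Dirs)) +
        #((univ.filter fun pd : Fin (padLen n i) → Bool => ¬ T < #(badPts g n i pd)).biUnion fun pd =>
          ({pd} : Finset _) ×ˢ (univ.filter fun ys : Dirs => ∃ x, corr (nodes n) (ptOracle g (List.ofFn pd)) ys x ≠ eval x (fam (K n) n i))) := by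
        exact_mod_cast h2
    _ ≤ _ := add_le_add hA hB

/-! ### The majority of independent trials -/

/-- **Hoeffding for the trials**: if at most a quarter of the trials are bad, then among the `s`-tuples
of trials those with at least `s/2` bad ones are at most `exp(−s/8) · |Trial|^s`.
[cite: AroraBarakCC2009, §7.4.1] -/
theorem card_badMajority_le_exp (g : List Bool → Bool) {s r : ℕ} (hs : 0 < s)
    (hfrac : 4 * #(badTrials g n i r) ≤ Fintype.card (Trial n i r)) :
    (#(univ.filter fun cs : Fin s → Trial n i r => ¬ s < 2 * #(univ.filter fun t => TrialGood g n i r (cs t))) : ℝ) ≤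
      Real.exp (-(s / 8 : ℝ)) * Fintype.card (Fin s → Trial n i r) := by
  classical
  have hne : Nonempty (Trial n i r) := ⟨(fun _ => false, fun _ _ => 0)⟩
  have h := card_upperDeviation_le_exp (α := Trial n i r) (fun c => ¬ TrialGood g n i r c) hs (η := 1 / 4) (by norm_num)
  have hexp : Real.exp (-2 * (s : ℝ) * (1 / 4) ^ 2) = Real.exp (-(s / 8 : ℝ)) := by congr 1; ring
  rw [hexp] at h
  refine le_trans ?_ h
  refine Nat.cast_le.2 (card_le_card fun cs hcs => ?_)
  simp only [mem_filter, mem_univ, true_and, not_lt] at hcs ⊢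
  -- #bad among the s trials ≥ s/2, and the density of bad is ≤ 1/4
  have hcnt : #(univ.filter fun t : Fin s => TrialGood g n i r (cs t)) + #(univ.filter fun t : Fin s => ¬ TrialGood g n i r (cs t)) = s := by
    rw [Finset.card_filter_add_card_filter_not, card_univ, Fintype.card_fin]
  have hdens : ((univ.filter fun c : Trial n i r => ¬ TrialGood g n i r c).card : ℝ) / Fintype.card (Trial n i r) ≤ 1 / 4 := by
    have hpos : (0 : ℝ) < Fintype.card (Trial n i r) := by exact_mod_cast Fintype.card_pos
    rw [div_le_div_iff₀ hpos (by norm_num)]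
    have : (4 * #(badTrials g n i r) : ℝ) ≤ Fintype.card (Trial n i r) := by exact_mod_cast hfrac
    have e : (univ.filter fun c : Trial n i r => ¬ TrialGood g n i r c) = badTrials g n i r := rfl
    rw [e]; linarith
  have hbad : (s : ℝ) / 2 ≤ #(univ.filter fun t : Fin s => ¬ TrialGood g n i r (cs t)) := by
    have h1 : (2 * #(univ.filter fun t : Fin s => TrialGood g n i r (cs t)) : ℝ) ≤ s := by exact_mod_cast hcs
    have h2 : (#(univ.filter fun t : Fin s => TrialGood g n i r (cs t)) : ℝ) +
        #(univ.filter fun t : Fin s => ¬ TrialGood g n i r (cs t)) = s := by exact_mod_cast hcnt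
    linarith
  have := mul_le_mul_of_nonneg_left hdens (Nat.cast_nonneg s)
  linarith

/-- **The majority-corrected function errs somewhere on `{0,1}^{h n i}` only on exponentially few
tuples of trials** (given that at most a quarter of the single trials are bad).
[cite: ImpagliazzoWigderson2001, Def. 5] [cite: TrevisanVadhan2007, Lemma 3.5] -/
theorem card_majCorrected_ne_le (hi : i ≤ mlen n) (g : List Bool → Bool) {s r : ℕ} (hs : 0 < s)
    (hfrac : 4 * #(badTrials g n i r) ≤ Fintype.card (Trial n i r)) :
    (#(univ.filter fun cs : Fin s → Trial n i r => ∃ w : List Bool, w.length = h n i ∧ majCorrected g n cs w ≠ FB w) : ℝ) ≤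
      Real.exp (-(s / 8 : ℝ)) * Fintype.card (Fin s → Trial n i r) := by
  classical
  refine le_trans (Nat.cast_le.2 (card_le_card fun cs hcs => ?_)) (card_badMajority_le_exp g hs hfrac)
  simp only [mem_filter, mem_univ, true_and] at hcs ⊢
  obtain ⟨w, hw, hne⟩ := hcs
  intro hgood
  exact hne (majCorrected_eq_FB hi g cs hgood hw)

end QBFUniv

end Literature.Computability.Complexity

end
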